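import Summits.HodgeConjecture.HodgeConjecture.Theorems.TropicalWeilObstructionTropicalHodgeBoundWeilEntries

/-!
# Crux `TropicalHodgeBound` (stmt-HodgeConjecture-18480), stub 4 — part G2: genericity turns the eigenwave
# identity into one integer linear equation per monomial

Route `TropicalWeilObstruction` of `HodgeConjecture`, registered line `birth`
(`Cruxes/TropicalHodgeBound/Lines/birth.lean`), stub `stub_rationalHodgeCoordinates`; ingredient (G).

Setting: `Q` a real symmetric `8 × 8` matrix commuting with `J = weilJ 4` whose `16` free entries are
algebraically independent over `ℚ` (`IsWeilGeneric 4 Q`), and an integer-valued function `y` on pairs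
of words `Fin 4 → Fin 8`, alternating in its first argument, such that for some `K' : Fin 5 → Fin 8`,
`J' : Fin 3 → Fin 8` the real identity
`Σ_m (-1)^m Σ_I det Q[K' ∘ m̂, I] · y(I, K'_m :: J') = 0` holds (for the integer coordinates of a
tropical cycle class this is the eigenwave identity, files `…CycleClassRational`, `…Eigenwave`).

* `sum_det_mul_eq_sum_prod` — for `f` alternating, `Σ_I det N[·, I] f(I) = 24 Σ_c (Π_a N_{a, c a}) f(c)`
  (Leibniz and reindexing; any commutative ring).
* `coeffEquation_eq_zero` — **one equation per monomial**: replacing `Q` by the symbolic matrix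
  `symEntry` (file `…WeilEntries`) the identity becomes `aeval t P = 0` for a polynomial
  `P ∈ ℚ[weilFreeIndex 4]`, hence `P = 0` by algebraic independence, hence every coefficient of `P`
  vanishes: for every reference term `(m₀, c₀)`,
  `Σ_{(m, c) : vars(m, c) ~ vars(m₀, c₀)} (-1)^m · signProd(K'∘m̂, c) · y(c, K'_m :: J') = 0`,
  where `vars(m, c)` is the list of the four free indices `entryIdx (K'(m̂ a)) (c a)` and `signProd` the
  product of the four signs `entrySign` (both computable; this is the form consumed by the certificate
  checker).

No named fact, no sorry.

References: [Zharkov2020TropicalWeil] I. Zharkov, arXiv:2002.02347, §2 ("very general" tropical Weil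
tori); [MikhalkinZharkov2014Eigenwave] G. Mikhalkin, I. Zharkov, LN UMI 15 (2014), Thm. 5.4.
-/

set_option linter.dupNamespace false

namespace Summit.HodgeConjecture.HodgeConjecture.Theorems.TropicalHodgeBound

open scoped BigOperators
open Matrix Literature.AlgebraicGeometry.Tropical

section Contract

variable {R : Type*} [CommRing R] {ι : Type*} [Fintype ι]

/-- **Leibniz + reindexing**: for `f` alternating on words,
`Σ_{I : Fin 4 → ι} det N[·, I] · f I = 24 · Σ_{c : Fin 4 → ι} (Π_a N a (c a)) · f c`. [folklore] -/
theorem sum_det_mul_eq_sum_prod (N : Matrix (Fin 4) ι R) (f : (Fin 4 → ι) → R)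
    (hf : ∀ (c : Fin 4 → ι) (τ : Equiv.Perm (Fin 4)), f (c ∘ τ) = ((Equiv.Perm.sign τ : ℤ) : R) * f c) :
    ∑ I : Fin 4 → ι, (N.submatrix id I).det * f I = 24 * ∑ c : Fin 4 → ι, (∏ a, N a (c a)) * f c := by
  have hσ : ∀ σ : Equiv.Perm (Fin 4), ∑ I : Fin 4 → ι,
      ((Equiv.Perm.sign σ : ℤ) : R) * (∏ i, (N.submatrix id I) (σ i) i) * f I =
      ∑ c : Fin 4 → ι, (∏ a, N a (c a)) * f c := by
    intro σ
    have hs2 : ((Equiv.Perm.sign σ : ℤ) : R) * ((Equiv.Perm.sign σ : ℤ) : R) = 1 := by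
      rw [← Int.cast_mul, ← Units.val_mul, Int.units_mul_self]; simp
    -- reindex `I = c ∘ σ`
    refine Fintype.sum_equiv (Equiv.arrowCongr σ (Equiv.refl ι)) _ _ fun I => ?_
    have hc : (Equiv.arrowCongr σ (Equiv.refl ι)) I = I ∘ ⇑σ.symm := by
      funext j; simp [Equiv.arrowCongr_apply]
    rw [hc]
    have hprod : ∏ i, (N.submatrix id I) (σ i) i = ∏ a, N a ((I ∘ ⇑σ.symm) a) := by
      refine Fintype.prod_equiv σ _ _ fun i => ?_
      simp
    rw [hprod]
    have hI : (I ∘ ⇑σ.symm) ∘ ⇑σ = I := by funext j; simp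
    -- `f I = sign σ * f (I ∘ σ⁻¹)` from alternation applied to `I ∘ σ⁻¹` and `σ`
    have hfI : f I = ((Equiv.Perm.sign σ : ℤ) : R) * f (I ∘ ⇑σ.symm) := by
      conv_lhs => rw [← hI]
      exact hf _ σ
    rw [hfI]
    calc ((Equiv.Perm.sign σ : ℤ) : R) * (∏ a, N a ((I ∘ ⇑σ.symm) a)) *
          (((Equiv.Perm.sign σ : ℤ) : R) * f (I ∘ ⇑σ.symm))
        = (((Equiv.Perm.sign σ : ℤ) : R) * ((Equiv.Perm.sign σ : ℤ) : R)) *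
            ((∏ a, N a ((I ∘ ⇑σ.symm) a)) * f (I ∘ ⇑σ.symm)) := by ring
      _ = (∏ a, N a ((I ∘ ⇑σ.symm) a)) * f (I ∘ ⇑σ.symm) := by rw [hs2, one_mul]
  calc ∑ I : Fin 4 → ι, (N.submatrix id I).det * f I
      = ∑ I : Fin 4 → ι, ∑ σ : Equiv.Perm (Fin 4),
          ((Equiv.Perm.sign σ : ℤ) : R) * (∏ i, (N.submatrix id I) (σ i) i) * f I := by
        refine Finset.sum_congr rfl fun I _ => ?_
        rw [Matrix.det_apply', Finset.sum_mul]
    _ = ∑ σ : Equiv.Perm (Fin 4), ∑ c : Fin 4 → ι, (∏ a, N a (c a)) * f c := by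
        rw [Finset.sum_comm]
        exact Finset.sum_congr rfl fun σ _ => hσ σ
    _ = 24 * ∑ c : Fin 4 → ι, (∏ a, N a (c a)) * f c := by
        rw [Finset.sum_const, Finset.card_univ, Fintype.card_perm, Fintype.card_fin, nsmul_eq_mul]
        norm_num [Nat.factorial]

end Contract

section Coefficients

/-- Decidable equality of free indices (the carrier `weilFreeIndex 4` is a subtype of `Fin 8 × Fin 8`). -/
instance instDecidableEqWeilFreeIndex : DecidableEq (weilFreeIndex 4) := by
  unfold weilFreeIndex; infer_instance

/-- The four free indices met by the term `(K, c)`: `entryIdx (K a) (c a)`, `a = 0, …, 3`.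
[cite: Zharkov2020TropicalWeil, §2] -/
def idxList (K c : Fin 4 → Fin (2 * 4)) : List (weilFreeIndex 4) :=
  [entryIdx (K 0) (c 0), entryIdx (K 1) (c 1), entryIdx (K 2) (c 2), entryIdx (K 3) (c 3)]

/-- The product of the four signs met by the term `(K, c)`. [cite: Zharkov2020TropicalWeil, §2] -/
def signProd (K c : Fin 4 → Fin (2 * 4)) : ℤ :=
  entrySign (K 0) (c 0) * entrySign (K 1) (c 1) * entrySign (K 2) (c 2) * entrySign (K 3) (c 3)

/-- The exponent (monomial) of the term `(K, c)`. [cite: Zharkov2020TropicalWeil, §2] -/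
noncomputable def monoOf (K c : Fin 4 → Fin (2 * 4)) : weilFreeIndex 4 →₀ ℕ :=
  ∑ a : Fin 4, Finsupp.single (entryIdx (K a) (c a)) 1

/-- The multiset of `monoOf` is the list `idxList`. [folklore] -/
theorem toMultiset_monoOf (K c : Fin 4 → Fin (2 * 4)) :
    Finsupp.toMultiset (monoOf K c) = (idxList K c : Multiset (weilFreeIndex 4)) := by
  rw [monoOf, Finsupp.toMultiset_sum, Fin.sum_univ_four]
  simp only [Finsupp.toMultiset_single, one_nsmul, idxList]
  rfl

/-- Two terms have the same monomial iff their index lists are permutations of each other.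
[folklore] -/
theorem monoOf_eq_iff (K c K' c' : Fin 4 → Fin (2 * 4)) :
    monoOf K c = monoOf K' c' ↔ (idxList K c).Perm (idxList K' c') := by
  rw [← Multiset.coe_eq_coe, ← toMultiset_monoOf, ← toMultiset_monoOf]
  constructor
  · intro h; rw [h]
  · intro h
    rw [← Finsupp.toMultiset_toFinsupp (monoOf K c), ← Finsupp.toMultiset_toFinsupp (monoOf K' c'), h]

/-- The product of the four symbolic entries of a term is the monomial `signProd · X^{monoOf}`.
[folklore] -/
theorem prod_symEntry (K c : Fin 4 → Fin (2 * 4)) :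
    ∏ a, symEntry (K a) (c a) = MvPolynomial.monomial (monoOf K c) (signProd K c : ℚ) := by
  rw [monoOf, show (signProd K c : ℚ) = ∏ a : Fin 4, (entrySign (K a) (c a) : ℚ) by
    rw [signProd, Fin.prod_univ_four]; push_cast; ring, MvPolynomial.monomial_sum_prod]
  rfl

variable {Q : Matrix (Fin (2 * 4)) (Fin (2 * 4)) ℝ}

/-- **One integer equation per monomial.** If the free entries of the symmetric `J`-commuting `Q`
are algebraically independent and the eigenwave identity
`Σ_m (-1)^m Σ_I det Q[K'∘m̂, I] · y(I, K'_m :: J') = 0` holds for an integer table `y` alternating in its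
first argument, then for every reference term `(m₀, c₀)` the signed `y`-values of all terms with the same
monomial sum to zero. [cite: Zharkov2020TropicalWeil, §2] -/
theorem coeffEquation_eq_zero (hS : ∀ α β, Q α β = Q β α) (hJ : Q * weilJ 4 = weilJ 4 * Q)
    (hgen : IsWeilGeneric 4 Q) (y : (Fin 4 → Fin (2 * 4)) → (Fin 4 → Fin (2 * 4)) → ℤ)
    (hy : ∀ (c d : Fin 4 → Fin (2 * 4)) (τ : Equiv.Perm (Fin 4)),
      y (c ∘ τ) d = ((Equiv.Perm.sign τ : ℤˣ) : ℤ) * y c d)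
    (K' : Fin 5 → Fin (2 * 4)) (J' : Fin 3 → Fin (2 * 4))
    (heig : ∑ m : Fin 5, (-1 : ℝ) ^ (m : ℕ) * ∑ I : Fin 4 → Fin (2 * 4),
      (Q.submatrix (fun a => K' (m.succAbove a)) I).det * (y I (Fin.cons (K' m) J') : ℝ) = 0)
    (m₀ : Fin 5) (c₀ : Fin 4 → Fin (2 * 4)) :
    ∑ m : Fin 5, ∑ c : Fin 4 → Fin (2 * 4),
      (if (idxList (fun a => K' (m.succAbove a)) c).Perm (idxList (fun a => K' (m₀.succAbove a)) c₀) then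
        (-1 : ℤ) ^ (m : ℕ) * signProd (fun a => K' (m.succAbove a)) c * y c (Fin.cons (K' m) J')
      else 0) = 0 := by
  classical
  -- the symbolic polynomial `P`
  let P : MvPolynomial (weilFreeIndex 4) ℚ := ∑ m : Fin 5, ∑ I : Fin 4 → Fin (2 * 4),
    MvPolynomial.C (((-1 : ℤ) ^ (m : ℕ) * y I (Fin.cons (K' m) J') : ℤ) : ℚ) *
      (Matrix.of fun a b => symEntry (K' (m.succAbove a)) (I b)).det
  -- its evaluation at the free entries is the eigenwave identity
  have hPeval : MvPolynomial.aeval (freeEntries Q) P = 0 := by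
    rw [← heig]
    simp only [P, map_sum, map_mul, MvPolynomial.aeval_C, ← det_submatrix_eq_aeval hS hJ]
    refine Finset.sum_congr rfl fun m _ => ?_
    rw [Finset.mul_sum]
    refine Finset.sum_congr rfl fun I _ => ?_
    simp only [eq_ratCast, Int.cast_mul, Int.cast_pow, Int.cast_neg, Int.cast_one]
    push_cast
    ring
  -- hence `P = 0`
  have hP : P = 0 := by
    have hinj : Function.Injective (MvPolynomial.aeval (freeEntries Q) :
        MvPolynomial (weilFreeIndex 4) ℚ →ₐ[ℚ] ℝ) := hgen
    exact hinj (by rw [hPeval, map_zero])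
  -- `P` as a sum of monomials
  have hPmono : P = ∑ m : Fin 5, ∑ c : Fin 4 → Fin (2 * 4), MvPolynomial.monomial
      (monoOf (fun a => K' (m.succAbove a)) c)
      ((24 : ℚ) * (((-1 : ℤ) ^ (m : ℕ) * signProd (fun a => K' (m.succAbove a)) c *
        y c (Fin.cons (K' m) J') : ℤ) : ℚ)) := by
    refine Finset.sum_congr rfl fun m _ => ?_
    have hcontract := sum_det_mul_eq_sum_prod
      (Matrix.of fun a b => symEntry (K' (m.succAbove a)) b)
      (fun I => MvPolynomial.C (((-1 : ℤ) ^ (m : ℕ) * y I (Fin.cons (K' m) J') : ℤ) : ℚ))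
      (fun c τ => by
        rw [hy c _ τ]
        simp only [Int.cast_mul, Int.cast_pow, Int.cast_neg, Int.cast_one, map_mul, map_intCast,
          map_pow, map_neg, map_one]
        push_cast
        ring)
    have hlhs : ∑ I : Fin 4 → Fin (2 * 4),
        MvPolynomial.C (((-1 : ℤ) ^ (m : ℕ) * y I (Fin.cons (K' m) J') : ℤ) : ℚ) *
          (Matrix.of fun a b => symEntry (K' (m.succAbove a)) (I b)).det =
        ∑ I : Fin 4 → Fin (2 * 4),
          ((Matrix.of fun a b => symEntry (K' (m.succAbove a)) b).submatrix id I).det *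
            MvPolynomial.C (((-1 : ℤ) ^ (m : ℕ) * y I (Fin.cons (K' m) J') : ℤ) : ℚ) :=
      Finset.sum_congr rfl fun I _ => by rw [mul_comm]; rfl
    rw [hlhs, hcontract, Finset.mul_sum]
    refine Finset.sum_congr rfl fun c _ => ?_
    rw [show (∏ a, (Matrix.of fun a b => symEntry (K' (m.succAbove a)) b) a (c a)) =
      ∏ a, symEntry (K' (m.succAbove a)) (c a) from rfl, prod_symEntry,
      mul_comm (MvPolynomial.monomial _ _) _, MvPolynomial.C_mul_monomial,
      show (24 : MvPolynomial (weilFreeIndex 4) ℚ) = MvPolynomial.C 24 from (map_ofNat _ 24).symm,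
      MvPolynomial.C_mul_monomial]
    congr 1
    push_cast; ring
  -- the coefficient of the reference monomial vanishes
  have hcoeff := congrArg (MvPolynomial.coeff (monoOf (fun a => K' (m₀.succAbove a)) c₀)) hP
  rw [hPmono, MvPolynomial.coeff_zero, MvPolynomial.coeff_sum] at hcoeff
  simp only [MvPolynomial.coeff_sum, MvPolynomial.coeff_monomial] at hcoeff
  -- compare with the claimed integer sum
  have hcast : ((∑ m : Fin 5, ∑ c : Fin 4 → Fin (2 * 4),
      (if (idxList (fun a => K' (m.succAbove a)) c).Perm (idxList (fun a => K' (m₀.succAbove a)) c₀)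
        then (-1 : ℤ) ^ (m : ℕ) * signProd (fun a => K' (m.succAbove a)) c * y c (Fin.cons (K' m) J')
        else 0 : ℤ) : ℤ) : ℚ) * 24 =
      ∑ m : Fin 5, ∑ c : Fin 4 → Fin (2 * 4),
        (if monoOf (fun a => K' (m.succAbove a)) c = monoOf (fun a => K' (m₀.succAbove a)) c₀ then
          (24 : ℚ) * (((-1 : ℤ) ^ (m : ℕ) * signProd (fun a => K' (m.succAbove a)) c *
            y c (Fin.cons (K' m) J') : ℤ) : ℚ) else 0) := by
    push_cast
    rw [Finset.sum_mul]
    refine Finset.sum_congr rfl fun m _ => ?_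
    rw [Finset.sum_mul]
    refine Finset.sum_congr rfl fun c _ => ?_
    by_cases h : (idxList (fun a => K' (m.succAbove a)) c).Perm (idxList (fun a => K' (m₀.succAbove a)) c₀)
    · rw [if_pos h, if_pos ((monoOf_eq_iff _ _ _ _).mpr h)]
      ring
    · rw [if_neg h, if_neg (mt (monoOf_eq_iff _ _ _ _).mp h)]
      simp
  have h24 : ((∑ m : Fin 5, ∑ c : Fin 4 → Fin (2 * 4),
      (if (idxList (fun a => K' (m.succAbove a)) c).Perm (idxList (fun a => K' (m₀.succAbove a)) c₀)
        then (-1 : ℤ) ^ (m : ℕ) * signProd (fun a => K' (m.succAbove a)) c * y c (Fin.cons (K' m) J')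
        else 0 : ℤ) : ℤ) : ℚ) * 24 = 0 := by
    rw [hcast]; exact hcoeff
  have h0 := (mul_eq_zero.mp h24).resolve_right (by norm_num)
  exact_mod_cast h0

end Coefficients

end Summit.HodgeConjecture.HodgeConjecture.Theorems.TropicalHodgeBound
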